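/-
Copyright (c) 2026. All rights reserved.
Released under Apache 2.0 license as described in the file LICENSE.
Authors: abc-iut cell, prover seat abc-iut-rh2-L1 (R-H round 2, row 27 «reach-ledger», gen 7).
-/
import Literature.IUT.LogVolume.UnitLogTieNotAttained
import Literature.IUT.LogVolume.UnitLogMaxNorm
import HarnessLib

/-!
# The largest norm on `log_p(𝒪_K^×)` AT A TIE `e = p^{a₀}·(p−1)`: the exact dichotomy, decided by ONE uniformizer

Proof-only sequel (theorems, no definitions, no named fact) of abc-iut-c312-3's `UnitLogMaxNorm.lean` (OFF the
cyclotomic indices the largest norm on `log_p(𝒪_K^×)` is the envelope `‖ϖ‖^{p^{a₀} − e·a₀}`, `isGreatest_norm_logUnits`;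
ON them only the upper bound `forall_mem_logUnits_norm_le_envelope` is claimed there), of abc-iut-rp-x2's
`UnitLogTieAttained.lean` (at a tie the envelope IS attained when `f ≥ 2`) and of this seat's
`UnitLogTieNotAttained.lean` (at CYCLOTOMIC TYPE — every element `π` of uniformizer norm fails the unit test
`‖1 + π^{p^{a₀}(p−1)}/p‖ < 1` — it is NOT attained: every `z ∈ log_p(𝒪_K^×)` has `‖z‖ ≤ ‖ϖ‖^{p^{a₀} − e·a₀ + 1}`).
Setting: `K` a proper ultrametric normed `ℚ_p`-algebra field (ANY prime `p`), `e = absRamificationIdx p K`,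
`f = residueDegree p K`, `ϖ` a norm uniformizer, `e = p^{a₀}·(p−1)` a cyclotomic index throughout.  PROVED:

* §1 **ONE UNIFORMIZER DECIDES THE TYPE.**  `f = 1` ⇒ every unit `w` has `‖w^{p−1} − 1‖ < 1` (`w̄ ∈ 𝔽_p^×`, Fermat;
  `norm_pow_sub_one_lt_one_of_residueDegree_eq_one`), so at `f = 1` the unit test gives THE SAME answer at every `π`
  of uniformizer norm (`1 + π^{e}/p = (1 + ϖ^{e}/p) + (ϖ^{e}/p)·(w^{e} − 1)`, `w = π/ϖ`, last term in `𝔪`;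
  `norm_one_add_pow_div_prime_lt_one_iff_of_residueDegree_eq_one`); and cyclotomic type FORCES `f = 1` (at `f ≥ 2`
  rp-x2's unit `c` off `𝔽_p` makes `c·ϖ` pass; `residueDegree_eq_one_of_cyclotomicType`).  So **cyclotomic type
  ⟺ `f = 1 ∧ ‖1 + ϖ^{e}/p‖ < 1`** for ONE (any) uniformizer, and **not ⟺ `f ≥ 2 ∨ ‖1 + ϖ^{e}/p‖ = 1`**.
* §2 **OFF CYCLOTOMIC TYPE THE ENVELOPE IS THE LARGEST NORM, ON A TIE TOO**: one passing `π` ⇒ `L(1 − π)` attains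
  `‖ϖ‖^{p^{a₀} − e·a₀}` (`exists_mem_logUnits_norm_eq_zpow_of_tie_of_unif`; Summits-side copy p483260 §0), whence
  `isGreatest_norm_logUnits_of_tie_of_not_cyclotomicType` (+ `_of_unif` / `_of_two_le_residueDegree`), `sSup_…`, and
  the read-out `norm_eq_zpow_of_isMaxOn_logUnits_of_tie_of_not_cyclotomicType` (+ `rpow` form): an element of largest
  norm in `log_p(𝒪_K^×)` has norm `‖ϖ‖^{p^{a₀} − e·a₀}` EXACTLY — the tie analogue of c312-3's `norm_eq_zpow_of_isMaxOn_logUnits`.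
* §3 **THE DICHOTOMY**: at a tie the envelope is the largest norm on `log_p(𝒪_K^×)` IFF `K` is not of cyclotomic type
  (`isGreatest_norm_logUnits_iff_not_cyclotomicType_of_tie`), **iff `f ≥ 2 ∨ ‖1 + ϖ^{e}/p‖ = 1`**
  (`isGreatest_norm_logUnits_iff_of_tie`); `outerRadius_dichotomy_of_tie`: EITHER the envelope is attained, OR `f = 1`,
  `‖1 + ϖ^{e}/p‖ < 1` and EVERY `z ∈ log_p(𝒪_K^×)` has `‖z‖ ≤ ‖ϖ‖^{p^{a₀} − e·a₀ + 1}` (e.g. `ℚ_p(ζ_p)`: `log_p(𝒪^×) = 𝔪²`).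

Consumer (record only; D-0079 R-H / D-0121 Q1, rh-lead R33–R34 bookings B77/B86): the table's outer order
`R_out = min_a (p^a − a·e_w)` of `log_p(𝒪^×_{K_w})` is EXACT off the ties (B86, `UnitLogMaxNorm.norm_eq_rpow_of_isMaxOn_logUnits`);
by this file it is ALSO EXACT at every tie place with `f_w ≥ 2` or with ONE uniformizer passing the unit test, and it
over-states the true outer radius by at least one `ϖ`-step exactly at the cyclotomic-type places (`f_w = 1` and
`ϖ^{e}/p ≡ −1 (mod 𝔪)` for one, hence every, uniformizer).  Classical `p`-adic analysis
[cite: NeukirchANT1999, Ch. II Prop. (3.8), (5.5)–(5.7)] [cite: Washington1997, Lemma 1.4, §5.1]; nothing here is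
disputed mathematics; no IUT statement is asserted; nothing bears on [IUTchIII] Cor. 3.12.
-/

noncomputable section

open Metric Set IsUltrametricDist IsLocalRing
open scoped Pointwise NormedField

namespace Literature.IUT.LogVolume

namespace ValuationProfile

open Literature.NumberTheory.GaloisRepresentations.Ultrametric RamificationCriterion LogEnvelope
  BoundaryRamification

section Field

variable (p : ℕ) [hp : Fact p.Prime]
variable {K : Type*} [NontriviallyNormedField K] [instK : NormedAlgebra ℚ_[p] K] [IsUltrametricDist K]
  [ProperSpace K]

/-! ### §0. Bookkeeping at a cyclotomic index -/

/-- At `e = p^{a₀}·(p−1)`: the integer form `e = 1·p^{a₀}·(p−1)` of the tie. [cite: NeukirchANT1999, Ch. II (5.5)] -/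
theorem cast_tie_of_eq {a₀ : ℕ} (he : absRamificationIdx p K = p ^ a₀ * (p - 1)) :
    (absRamificationIdx p K : ℤ) = 1 * (p : ℤ) ^ a₀ * ((p : ℤ) - 1) := by
  rw [he]; push_cast [Nat.cast_sub hp.out.one_le]; ring

/-- At `e = p^{a₀}·(p−1)` the exponent `a₀` is a (non-strict) turning point of `a ↦ p^a − e·a`:
`p^a·(p−1) < e` for `a < a₀` and `e ≤ p^{a₀}·(p−1)`. [cite: NeukirchANT1999, Ch. II (5.5)] -/
theorem turning_of_tie {a₀ : ℕ} (he : absRamificationIdx p K = p ^ a₀ * (p - 1)) :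
    (∀ a < a₀, (p : ℤ) ^ a * ((p : ℤ) - 1) < absRamificationIdx p K) ∧
      (absRamificationIdx p K : ℤ) ≤ (p : ℤ) ^ a₀ * ((p : ℤ) - 1) := by
  have htie := cast_tie_of_eq p he
  rw [one_mul] at htie
  refine ⟨fun a ha => ?_, htie.le⟩
  rw [htie]
  have hP : (2 : ℤ) ≤ (p : ℤ) := by exact_mod_cast hp.out.two_le
  have hpow : (p : ℤ) ^ a < (p : ℤ) ^ a₀ := pow_lt_pow_right₀ (by linarith) ha
  have h1 : (0 : ℤ) < (p : ℤ) - 1 := by linarith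
  nlinarith

/-- At `e = p^{a₀}·(p−1)` the fixed element `w = ϖ^{p^{a₀}(p−1)}/p` is a unit. [cite: NeukirchANT1999, Ch. II (5.5)] -/
theorem norm_unif_pow_div_prime_eq_one_of_tie {ϖ : Kˣ} (hϖ : IsUniformizer ϖ) {a₀ : ℕ}
    (he : absRamificationIdx p K = p ^ a₀ * (p - 1)) :
    ‖(ϖ : K) ^ (p ^ a₀ * (p - 1)) / (p : K)‖ = 1 :=
  norm_pow_div_prime_eq_one_of_tie p hϖ (s := 1) (by rw [zpow_one]) (cast_tie_of_eq p he)

/-- At `e = p^{a₀}·(p−1)`, for every `π` of uniformizer norm: `‖1 + π^{p^{a₀}(p−1)}/p‖ ≤ 1`.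
[cite: NeukirchANT1999, Ch. II (5.5)] -/
theorem norm_one_add_pow_div_prime_le_one_of_tie {ϖ : Kˣ} (hϖ : IsUniformizer ϖ) {a₀ : ℕ}
    (he : absRamificationIdx p K = p ^ a₀ * (p - 1)) {π : K} (hπ : ‖π‖ = ‖(ϖ : K)‖) :
    ‖1 + π ^ (p ^ a₀ * (p - 1)) / (p : K)‖ ≤ 1 := by
  have hw : ‖π ^ (p ^ a₀ * (p - 1)) / (p : K)‖ = 1 :=
    norm_pow_div_prime_eq_one_of_tie p hϖ (s := 1) (by rw [zpow_one, hπ]) (cast_tie_of_eq p he)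
  refine (norm_add_le_max _ _).trans ?_
  rw [norm_one, hw, max_self]

/-! ### §1. One uniformizer decides the type -/

omit hp instK [ProperSpace K] in
/-- `‖d − 1‖ < 1 ⇒ ‖d^m − 1‖ < 1` (`d^{m+1} − 1 = d·(d^m − 1) + (d − 1)`, ultrametric). [cite: NeukirchANT1999, Ch. II (3.8)] -/
theorem norm_pow_sub_one_lt_one_of_norm_sub_one_lt_one {d : K} (hd : ‖d - 1‖ < 1) (m : ℕ) :
    ‖d ^ m - 1‖ < 1 := by
  have hd1 : ‖d‖ ≤ 1 := by
    have h := norm_add_le_max (d - 1) (1 : K)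
    rw [sub_add_cancel, norm_one] at h
    exact h.trans (max_le hd.le le_rfl)
  induction m with
  | zero => rw [pow_zero, sub_self, norm_zero]; exact one_pos
  | succ m ih =>
    have hsplit : d ^ (m + 1) - 1 = d * (d ^ m - 1) + (d - 1) := by ring
    rw [hsplit]
    refine (norm_add_le_max _ _).trans_lt (max_lt ?_ hd)
    rw [norm_mul]
    exact (mul_le_of_le_one_left (norm_nonneg _) hd1).trans_lt ih

/-- **`f = 1` ⇒ every unit `w` has `‖w^{p−1} − 1‖ < 1`**: the residue `w̄` lies in the prime field `𝔽_p = 𝒪/𝔪`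
(`#(𝒪/𝔪) = p^f = p`), and `w̄^{p−1} = 1` there. [cite: NeukirchANT1999, Ch. II Prop. (3.8)] [cite: Washington1997, §5.1] -/
theorem norm_pow_sub_one_lt_one_of_residueDegree_eq_one (hf : residueDegree p K = 1) {w : K}
    (hw : ‖w‖ = 1) : ‖w ^ (p - 1) - 1‖ < 1 := by
  haveI : Finite (ResidueField (Valued.integer K)) := finite_residueField
  letI : Fintype (ResidueField (Valued.integer K)) := Fintype.ofFinite _
  have hcard : Fintype.card (ResidueField (Valued.integer K)) = p := by
    rw [← Nat.card_eq_fintype_card, card_residueField p K, hf, pow_one]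
  let W : Valued.integer K := ⟨w, Valued.integer.mem_iff.mpr hw.le⟩
  have hW : residue (Valued.integer K) W ≠ 0 := residue_ne_zero_of_norm_eq_one W hw
  have hpow : residue (Valued.integer K) W ^ (p - 1) = 1 := by
    rw [← hcard]; exact FiniteField.pow_card_sub_one_eq_one _ hW
  have h0 : residue (Valued.integer K) (W ^ (p - 1) - 1) = 0 := by
    rw [map_sub, map_pow, map_one, hpow, sub_self]
  have h := (residue_eq_zero_iff_norm_lt_one (W ^ (p - 1) - 1)).mp h0
  have hcoe : ((W ^ (p - 1) - 1 : Valued.integer K) : K) = w ^ (p - 1) - 1 := by push_cast; rfl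
  rwa [hcoe] at h

/-- `f = 1` ⇒ every unit `w` has `‖w^{p^{a₀}(p−1)} − 1‖ < 1`. [cite: NeukirchANT1999, Ch. II Prop. (3.8)] -/
theorem norm_pow_cyclIndex_sub_one_lt_one_of_residueDegree_eq_one (hf : residueDegree p K = 1) {w : K}
    (hw : ‖w‖ = 1) (a₀ : ℕ) : ‖w ^ (p ^ a₀ * (p - 1)) - 1‖ < 1 := by
  rw [mul_comm, pow_mul]
  exact norm_pow_sub_one_lt_one_of_norm_sub_one_lt_one
    (norm_pow_sub_one_lt_one_of_residueDegree_eq_one p hf hw) _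

omit hp instK [ProperSpace K] in
/-- `‖D‖ < 1 ⇒ (‖A + D‖ < 1 ⟺ ‖A‖ < 1)` (ultrametric). [cite: NeukirchANT1999, Ch. II (3.8)] -/
theorem norm_add_lt_one_iff_of_norm_lt_one {A D : K} (hD : ‖D‖ < 1) : ‖A + D‖ < 1 ↔ ‖A‖ < 1 := by
  refine ⟨fun h => ?_, fun h => (norm_add_le_max _ _).trans_lt (max_lt h hD)⟩
  have h' := norm_add_le_max (A + D) (-D)
  rw [add_neg_cancel_right, norm_neg] at h'
  exact h'.trans_lt (max_lt h hD)

/-- **ONE UNIFORMIZER DECIDES (at `f = 1`).**  At `e = p^{a₀}·(p−1)` with `residueDegree = 1`, for every `π` of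
uniformizer norm: `‖1 + π^{p^{a₀}(p−1)}/p‖ < 1 ⟺ ‖1 + ϖ^{p^{a₀}(p−1)}/p‖ < 1` — since
`1 + π^{e}/p = (1 + ϖ^{e}/p) + (ϖ^{e}/p)·(w^{e} − 1)` with `w = π/ϖ` a unit and `‖w^{e} − 1‖ < 1` (§1).
(At `f = 1` the residue `π^e/p mod 𝔪 ∈ 𝔽_p^×` does not depend on the uniformizer.)
[cite: NeukirchANT1999, Ch. II Prop. (3.8), (5.5)] [cite: Washington1997, §5.1] -/
theorem norm_one_add_pow_div_prime_lt_one_iff_of_residueDegree_eq_one {ϖ : Kˣ} (hϖ : IsUniformizer ϖ)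
    {a₀ : ℕ} (he : absRamificationIdx p K = p ^ a₀ * (p - 1)) (hf : residueDegree p K = 1) {π : K}
    (hπ : ‖π‖ = ‖(ϖ : K)‖) :
    ‖1 + π ^ (p ^ a₀ * (p - 1)) / (p : K)‖ < 1 ↔ ‖1 + (ϖ : K) ^ (p ^ a₀ * (p - 1)) / (p : K)‖ < 1 := by
  have hϖ0 : (ϖ : K) ≠ 0 := ϖ.ne_zero
  set w : K := π / (ϖ : K) with hw_def
  have hw : ‖w‖ = 1 := by rw [hw_def, norm_div, hπ, div_self (norm_ne_zero_iff.mpr hϖ0)]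
  have hπw : π = w * (ϖ : K) := by rw [hw_def, div_mul_cancel₀ _ hϖ0]
  have hsplit : 1 + π ^ (p ^ a₀ * (p - 1)) / (p : K) =
      (1 + (ϖ : K) ^ (p ^ a₀ * (p - 1)) / (p : K)) +
        (ϖ : K) ^ (p ^ a₀ * (p - 1)) / (p : K) * (w ^ (p ^ a₀ * (p - 1)) - 1) := by
    rw [hπw, mul_pow]; ring
  have hD : ‖(ϖ : K) ^ (p ^ a₀ * (p - 1)) / (p : K) * (w ^ (p ^ a₀ * (p - 1)) - 1)‖ < 1 := by
    rw [norm_mul, norm_unif_pow_div_prime_eq_one_of_tie p hϖ he, one_mul]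
    exact norm_pow_cyclIndex_sub_one_lt_one_of_residueDegree_eq_one p hf hw a₀
  rw [hsplit]
  exact norm_add_lt_one_iff_of_norm_lt_one hD

/-- At `f = 1`: cyclotomic type (EVERY `π` of uniformizer norm fails the unit test) ⟺ ONE uniformizer fails it.
[cite: NeukirchANT1999, Ch. II Prop. (3.8), (5.5)] [cite: Washington1997, §5.1] -/
theorem forall_norm_one_add_pow_div_prime_lt_one_iff_of_residueDegree_eq_one {ϖ : Kˣ} (hϖ : IsUniformizer ϖ)
    {a₀ : ℕ} (he : absRamificationIdx p K = p ^ a₀ * (p - 1)) (hf : residueDegree p K = 1) :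
    (∀ π : K, ‖π‖ = ‖(ϖ : K)‖ → ‖1 + π ^ (p ^ a₀ * (p - 1)) / (p : K)‖ < 1) ↔
      ‖1 + (ϖ : K) ^ (p ^ a₀ * (p - 1)) / (p : K)‖ < 1 :=
  ⟨fun h => h _ rfl,
    fun h _ hπ => (norm_one_add_pow_div_prime_lt_one_iff_of_residueDegree_eq_one p hϖ he hf hπ).mpr h⟩

/-- **CYCLOTOMIC TYPE FORCES `f = 1`.**  At `e = p^{a₀}·(p−1)`: if every `π` of uniformizer norm fails the unit test
then `residueDegree p K = 1` — at `f ≥ 2` abc-iut-rp-x2's unit `c` with `c̄ ∉ 𝔽_p`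
(`exists_norm_one_add_mul_pow_eq_one`) makes `π = c·ϖ` pass. [cite: Washington1997, §5.1] -/
theorem residueDegree_eq_one_of_cyclotomicType {ϖ : Kˣ} (hϖ : IsUniformizer ϖ) {a₀ : ℕ}
    (he : absRamificationIdx p K = p ^ a₀ * (p - 1))
    (hcyc : ∀ π : K, ‖π‖ = ‖(ϖ : K)‖ → ‖1 + π ^ (p ^ a₀ * (p - 1)) / (p : K)‖ < 1) :
    residueDegree p K = 1 := by
  have hpos := residueDegree_pos p K
  by_contra hne
  have hf : 2 ≤ residueDegree p K := by omega
  obtain ⟨c, hc, hcu⟩ :=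
    exists_norm_one_add_mul_pow_eq_one p hf (norm_unif_pow_div_prime_eq_one_of_tie p hϖ he) a₀
  have hπ : ‖c * (ϖ : K)‖ = ‖(ϖ : K)‖ := by rw [norm_mul, hc, one_mul]
  have h := hcyc (c * (ϖ : K)) hπ
  rw [mul_pow, show c ^ (p ^ a₀ * (p - 1)) * (ϖ : K) ^ (p ^ a₀ * (p - 1)) / (p : K)
      = (ϖ : K) ^ (p ^ a₀ * (p - 1)) / (p : K) * c ^ (p ^ a₀ * (p - 1)) from by ring] at h
  exact absurd hcu (ne_of_lt h)

/-- **THE TYPE TEST.**  At `e = p^{a₀}·(p−1)`: cyclotomic type ⟺ `f = 1 ∧ ‖1 + ϖ^{p^{a₀}(p−1)}/p‖ < 1` — one residue of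
ONE uniformizer decides. [cite: NeukirchANT1999, Ch. II Prop. (3.8), (5.5)] [cite: Washington1997, §5.1] -/
theorem cyclotomicType_iff_residueDegree_eq_one_and_norm_lt_one {ϖ : Kˣ} (hϖ : IsUniformizer ϖ) {a₀ : ℕ}
    (he : absRamificationIdx p K = p ^ a₀ * (p - 1)) :
    (∀ π : K, ‖π‖ = ‖(ϖ : K)‖ → ‖1 + π ^ (p ^ a₀ * (p - 1)) / (p : K)‖ < 1) ↔
      residueDegree p K = 1 ∧ ‖1 + (ϖ : K) ^ (p ^ a₀ * (p - 1)) / (p : K)‖ < 1 := by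
  exact ⟨fun hcyc => ⟨residueDegree_eq_one_of_cyclotomicType p hϖ he hcyc, hcyc _ rfl⟩,
    fun ⟨hf, h⟩ => (forall_norm_one_add_pow_div_prime_lt_one_iff_of_residueDegree_eq_one p hϖ he hf).mpr h⟩

/-- **NOT of cyclotomic type ⟺ `f ≥ 2 ∨ ‖1 + ϖ^{p^{a₀}(p−1)}/p‖ = 1`** (at `e = p^{a₀}·(p−1)`).
[cite: NeukirchANT1999, Ch. II Prop. (3.8), (5.5)] [cite: Washington1997, §5.1] -/
theorem not_cyclotomicType_iff_of_tie {ϖ : Kˣ} (hϖ : IsUniformizer ϖ) {a₀ : ℕ}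
    (he : absRamificationIdx p K = p ^ a₀ * (p - 1)) :
    (¬ ∀ π : K, ‖π‖ = ‖(ϖ : K)‖ → ‖1 + π ^ (p ^ a₀ * (p - 1)) / (p : K)‖ < 1) ↔
      2 ≤ residueDegree p K ∨ ‖1 + (ϖ : K) ^ (p ^ a₀ * (p - 1)) / (p : K)‖ = 1 := by
  rw [cyclotomicType_iff_residueDegree_eq_one_and_norm_lt_one p hϖ he, not_and_or]
  have hpos := residueDegree_pos p K
  have hle := norm_one_add_pow_div_prime_le_one_of_tie p hϖ he (π := (ϖ : K)) rfl
  constructor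
  · rintro (hf | h)
    · exact Or.inl (by omega)
    · exact Or.inr (le_antisymm hle (not_lt.mp h))
  · rintro (hf | h)
    · exact Or.inl (by omega)
    · exact Or.inr (by rw [h]; exact lt_irrefl _)

/-! ### §2. Off cyclotomic type the envelope is the largest norm, on a tie too -/

/-- **Attainment from ONE passing element** (Literature-side form of p483260 §0): at `e = p^{a₀}·(p−1)`, an element
`π` of uniformizer norm with `‖1 + π^{p^{a₀}(p−1)}/p‖ = 1` gives `z = L(1 − π) ∈ log_p(𝒪_K^×)` with
`‖z‖ = ‖ϖ‖^{p^{a₀} − e·a₀}` EXACTLY (the two tying terms do not cancel). [cite: NeukirchANT1999, Ch. II Prop. (5.5)] -/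
theorem exists_mem_logUnits_norm_eq_zpow_of_tie_of_unif {ϖ : Kˣ} (hϖ : IsUniformizer ϖ) {a₀ : ℕ}
    (he : absRamificationIdx p K = p ^ a₀ * (p - 1)) {π : K} (hπ : ‖π‖ = ‖(ϖ : K)‖)
    (hunit : ‖1 + π ^ (p ^ a₀ * (p - 1)) / (p : K)‖ = 1) :
    ∃ z ∈ logUnits K, ‖z‖ = ‖(ϖ : K)‖ ^ ((p : ℤ) ^ a₀ - (absRamificationIdx p K : ℤ) * (a₀ : ℤ)) := by
  have htie := cast_tie_of_eq p he
  have hlo := (turning_of_tie p he).1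
  set y : K := 1 - π with hy_def
  have hx : (1 : K) - y = π := by rw [hy_def]; ring
  have hy : ‖1 - y‖ = ‖(ϖ : K)‖ ^ (1 : ℤ) := by rw [hx, hπ, zpow_one]
  have hyP : IsPrincipal y := by
    show ‖1 - y‖ < 1
    rw [hy, zpow_one]
    exact hϖ.1
  have hunit' : ‖1 + (1 - y) ^ (p ^ a₀ * (p - 1)) / (p : K)‖ = 1 := by rw [hx]; exact hunit
  have hlo' : ∀ a < a₀, (1 : ℤ) * (p : ℤ) ^ a * ((p : ℤ) - 1) < absRamificationIdx p K := by
    intro a ha; rw [one_mul]; exact hlo a ha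
  refine ⟨logSeries y, ?_, ?_⟩
  · rw [← unitLog_of_isPrincipal p hyP]
    exact unitLog_mem_logUnits hyP.norm_eq_one
  · rw [norm_logSeries_eq_zpow_of_tie_of_unit p hϖ hyP hy hlo' htie hunit', one_mul]

/-- **Attainment off cyclotomic type**: at `e = p^{a₀}·(p−1)`, if NOT every `π` of uniformizer norm fails the unit
test, some `z ∈ log_p(𝒪_K^×)` has `‖z‖ = ‖ϖ‖^{p^{a₀} − e·a₀}`. [cite: NeukirchANT1999, Ch. II Prop. (5.5)] -/
theorem exists_mem_logUnits_norm_eq_zpow_of_tie_of_not_cyclotomicType {ϖ : Kˣ} (hϖ : IsUniformizer ϖ)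
    {a₀ : ℕ} (he : absRamificationIdx p K = p ^ a₀ * (p - 1))
    (hnc : ¬ ∀ π : K, ‖π‖ = ‖(ϖ : K)‖ → ‖1 + π ^ (p ^ a₀ * (p - 1)) / (p : K)‖ < 1) :
    ∃ z ∈ logUnits K, ‖z‖ = ‖(ϖ : K)‖ ^ ((p : ℤ) ^ a₀ - (absRamificationIdx p K : ℤ) * (a₀ : ℤ)) := by
  push Not at hnc
  obtain ⟨π, hπ, hge⟩ := hnc
  exact exists_mem_logUnits_norm_eq_zpow_of_tie_of_unif p hϖ he hπ
    (le_antisymm (norm_one_add_pow_div_prime_le_one_of_tie p hϖ he hπ) hge)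

/-- **OFF CYCLOTOMIC TYPE THE LARGEST NORM ON `log_p(𝒪_K^×)` IS THE ENVELOPE `‖ϖ‖^{p^{a₀} − e·a₀}`, at a tie**
(`IsGreatest`; upper bound = c312-3's `forall_mem_logUnits_norm_le_envelope` at the turning point `a₀`).
[cite: NeukirchANT1999, Ch. II Prop. (5.5)] -/
theorem isGreatest_norm_logUnits_of_tie_of_not_cyclotomicType {ϖ : Kˣ} (hϖ : IsUniformizer ϖ) {a₀ : ℕ}
    (he : absRamificationIdx p K = p ^ a₀ * (p - 1))
    (hnc : ¬ ∀ π : K, ‖π‖ = ‖(ϖ : K)‖ → ‖1 + π ^ (p ^ a₀ * (p - 1)) / (p : K)‖ < 1) :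
    IsGreatest ((fun z : K => ‖z‖) '' logUnits K)
      (‖(ϖ : K)‖ ^ ((p : ℤ) ^ a₀ - (absRamificationIdx p K : ℤ) * (a₀ : ℤ))) := by
  obtain ⟨z, hz, hzn⟩ := exists_mem_logUnits_norm_eq_zpow_of_tie_of_not_cyclotomicType p hϖ he hnc
  obtain ⟨hlo, hhi⟩ := turning_of_tie p he
  refine ⟨⟨z, hz, hzn⟩, ?_⟩
  rintro r ⟨w, hw, rfl⟩
  exact forall_mem_logUnits_norm_le_envelope p hϖ hlo hhi w hw

/-- The same from ONE passing element `π` (`‖π‖ = ‖ϖ‖`, `‖1 + π^{p^{a₀}(p−1)}/p‖ = 1`).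
[cite: NeukirchANT1999, Ch. II Prop. (5.5)] -/
theorem isGreatest_norm_logUnits_of_tie_of_unif {ϖ : Kˣ} (hϖ : IsUniformizer ϖ) {a₀ : ℕ}
    (he : absRamificationIdx p K = p ^ a₀ * (p - 1)) {π : K} (hπ : ‖π‖ = ‖(ϖ : K)‖)
    (hunit : ‖1 + π ^ (p ^ a₀ * (p - 1)) / (p : K)‖ = 1) :
    IsGreatest ((fun z : K => ‖z‖) '' logUnits K)
      (‖(ϖ : K)‖ ^ ((p : ℤ) ^ a₀ - (absRamificationIdx p K : ℤ) * (a₀ : ℤ))) := by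
  refine isGreatest_norm_logUnits_of_tie_of_not_cyclotomicType p hϖ he fun hcyc => ?_
  have h := hcyc π hπ
  rw [hunit] at h
  exact lt_irrefl _ h

/-- The same when `f ≥ 2` (abc-iut-rp-x2's `UnitLogTieAttained`: the envelope is attained; here packaged as
`IsGreatest`). [cite: NeukirchANT1999, Ch. II Prop. (5.5)] [cite: Washington1997, §5.1] -/
theorem isGreatest_norm_logUnits_of_tie_of_two_le_residueDegree {ϖ : Kˣ} (hϖ : IsUniformizer ϖ) {a₀ : ℕ}
    (he : absRamificationIdx p K = p ^ a₀ * (p - 1)) (hf : 2 ≤ residueDegree p K) :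
    IsGreatest ((fun z : K => ‖z‖) '' logUnits K)
      (‖(ϖ : K)‖ ^ ((p : ℤ) ^ a₀ - (absRamificationIdx p K : ℤ) * (a₀ : ℤ))) := by
  refine isGreatest_norm_logUnits_of_tie_of_not_cyclotomicType p hϖ he fun hcyc => ?_
  have h1 := residueDegree_eq_one_of_cyclotomicType p hϖ he hcyc
  omega

/-- `sup ‖·‖` over `log_p(𝒪_K^×)` equals the envelope at a tie off cyclotomic type. [cite: NeukirchANT1999, Ch. II Prop. (5.5)] -/
theorem sSup_norm_logUnits_of_tie_of_not_cyclotomicType {ϖ : Kˣ} (hϖ : IsUniformizer ϖ) {a₀ : ℕ}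
    (he : absRamificationIdx p K = p ^ a₀ * (p - 1))
    (hnc : ¬ ∀ π : K, ‖π‖ = ‖(ϖ : K)‖ → ‖1 + π ^ (p ^ a₀ * (p - 1)) / (p : K)‖ < 1) :
    sSup ((fun z : K => ‖z‖) '' logUnits K)
      = ‖(ϖ : K)‖ ^ ((p : ℤ) ^ a₀ - (absRamificationIdx p K : ℤ) * (a₀ : ℤ)) :=
  (isGreatest_norm_logUnits_of_tie_of_not_cyclotomicType p hϖ he hnc).csSup_eq

/-- **An element of largest norm in `log_p(𝒪_K^×)` has norm `‖ϖ‖^{p^{a₀} − e·a₀}` EXACTLY, at a tie off cyclotomic type**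
— the tie analogue of c312-3's `norm_eq_zpow_of_isMaxOn_logUnits` (the read-out the R-H table's `R_out` column uses).
[cite: NeukirchANT1999, Ch. II Prop. (5.5)] -/
theorem norm_eq_zpow_of_isMaxOn_logUnits_of_tie_of_not_cyclotomicType {ϖ : Kˣ} (hϖ : IsUniformizer ϖ) {a₀ : ℕ}
    (he : absRamificationIdx p K = p ^ a₀ * (p - 1))
    (hnc : ¬ ∀ π : K, ‖π‖ = ‖(ϖ : K)‖ → ‖1 + π ^ (p ^ a₀ * (p - 1)) / (p : K)‖ < 1) {z : K}
    (hzmem : z ∈ logUnits K) (hz : ∀ w ∈ logUnits K, ‖w‖ ≤ ‖z‖) :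
    ‖z‖ = ‖(ϖ : K)‖ ^ ((p : ℤ) ^ a₀ - (absRamificationIdx p K : ℤ) * (a₀ : ℤ)) := by
  obtain ⟨⟨z₀, hz₀, hz₀n⟩, hub⟩ := isGreatest_norm_logUnits_of_tie_of_not_cyclotomicType p hϖ he hnc
  exact le_antisymm (hub ⟨z, hzmem, rfl⟩) (hz₀n ▸ hz z₀ hz₀)

/-- The same in `p^{−λ}` form: `‖z^max‖ = p^{−(p^{a₀} − e·a₀)/e}` at a tie off cyclotomic type.
[cite: NeukirchANT1999, Ch. II Prop. (5.5)] -/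
theorem norm_eq_rpow_of_isMaxOn_logUnits_of_tie_of_not_cyclotomicType {ϖ : Kˣ} (hϖ : IsUniformizer ϖ) {a₀ : ℕ}
    (he : absRamificationIdx p K = p ^ a₀ * (p - 1))
    (hnc : ¬ ∀ π : K, ‖π‖ = ‖(ϖ : K)‖ → ‖1 + π ^ (p ^ a₀ * (p - 1)) / (p : K)‖ < 1) {z : K}
    (hzmem : z ∈ logUnits K) (hz : ∀ w ∈ logUnits K, ‖w‖ ≤ ‖z‖) :
    ‖z‖ = (p : ℝ) ^ (-((((p : ℤ) ^ a₀ - (absRamificationIdx p K : ℤ) * (a₀ : ℤ) : ℤ) : ℝ)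
      / (absRamificationIdx p K : ℝ))) := by
  have hp0 : (0 : ℝ) ≤ p := by positivity
  rw [norm_eq_zpow_of_isMaxOn_logUnits_of_tie_of_not_cyclotomicType p hϖ he hnc hzmem hz,
    norm_eq_rpow_of_isUniformizer p K hϖ, ← Real.rpow_intCast, ← Real.rpow_mul hp0]
  congr 1
  ring

/-! ### §3. The dichotomy -/

/-- **At a tie the envelope is the largest norm on `log_p(𝒪_K^×)` IFF `K` is not of cyclotomic type** (at cyclotomic
type every log-unit is one step inside the envelope, `norm_le_zpow_succ_of_mem_logUnits_of_cyclotomicType`).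
[cite: NeukirchANT1999, Ch. II Prop. (5.5)–(5.7)] [cite: Washington1997, Lemma 1.4, §5.1] -/
theorem isGreatest_norm_logUnits_iff_not_cyclotomicType_of_tie {ϖ : Kˣ} (hϖ : IsUniformizer ϖ) {a₀ : ℕ}
    (he : absRamificationIdx p K = p ^ a₀ * (p - 1)) :
    IsGreatest ((fun z : K => ‖z‖) '' logUnits K)
        (‖(ϖ : K)‖ ^ ((p : ℤ) ^ a₀ - (absRamificationIdx p K : ℤ) * (a₀ : ℤ))) ↔
      ¬ ∀ π : K, ‖π‖ = ‖(ϖ : K)‖ → ‖1 + π ^ (p ^ a₀ * (p - 1)) / (p : K)‖ < 1 := by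
  refine ⟨fun hgr hcyc => ?_, isGreatest_norm_logUnits_of_tie_of_not_cyclotomicType p hϖ he⟩
  obtain ⟨⟨z, hz, hzn⟩, -⟩ := hgr
  exact not_exists_mem_logUnits_zpow_le_norm_of_cyclotomicType p hϖ he hcyc ⟨z, hz, hzn.symm.le⟩

/-- **ONE UNIFORMIZER DECIDES THE OUTER RADIUS AT A TIE**: the envelope `‖ϖ‖^{p^{a₀} − e·a₀}` is the largest norm on
`log_p(𝒪_K^×)` ⟺ `f ≥ 2 ∨ ‖1 + ϖ^{p^{a₀}(p−1)}/p‖ = 1`. [cite: NeukirchANT1999, Ch. II Prop. (5.5)–(5.7)]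
[cite: Washington1997, Lemma 1.4, §5.1] -/
theorem isGreatest_norm_logUnits_iff_of_tie {ϖ : Kˣ} (hϖ : IsUniformizer ϖ) {a₀ : ℕ}
    (he : absRamificationIdx p K = p ^ a₀ * (p - 1)) :
    IsGreatest ((fun z : K => ‖z‖) '' logUnits K)
        (‖(ϖ : K)‖ ^ ((p : ℤ) ^ a₀ - (absRamificationIdx p K : ℤ) * (a₀ : ℤ))) ↔
      2 ≤ residueDegree p K ∨ ‖1 + (ϖ : K) ^ (p ^ a₀ * (p - 1)) / (p : K)‖ = 1 := by
  rw [isGreatest_norm_logUnits_iff_not_cyclotomicType_of_tie p hϖ he, not_cyclotomicType_iff_of_tie p hϖ he]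

/-- **THE OUTER-RADIUS DICHOTOMY AT A TIE `e = p^{a₀}·(p−1)`.**  EITHER the envelope `‖ϖ‖^{p^{a₀} − e·a₀}` is the
largest norm on `log_p(𝒪_K^×)` (attained: `f ≥ 2`, or one uniformizer passes the unit test), OR `K` is of cyclotomic
type — `f = 1` and `‖1 + ϖ^{p^{a₀}(p−1)}/p‖ < 1` for one (every) uniformizer — and then EVERY `z ∈ log_p(𝒪_K^×)` has
`‖z‖ ≤ ‖ϖ‖^{p^{a₀} − e·a₀ + 1}`, one step inside. [cite: NeukirchANT1999, Ch. II Prop. (5.5)–(5.7)]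
[cite: Washington1997, Lemma 1.4, §5.1] -/
theorem outerRadius_dichotomy_of_tie {ϖ : Kˣ} (hϖ : IsUniformizer ϖ) {a₀ : ℕ}
    (he : absRamificationIdx p K = p ^ a₀ * (p - 1)) :
    IsGreatest ((fun z : K => ‖z‖) '' logUnits K)
        (‖(ϖ : K)‖ ^ ((p : ℤ) ^ a₀ - (absRamificationIdx p K : ℤ) * (a₀ : ℤ))) ∨
      (residueDegree p K = 1 ∧ ‖1 + (ϖ : K) ^ (p ^ a₀ * (p - 1)) / (p : K)‖ < 1 ∧
        ∀ z ∈ logUnits K,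
          ‖z‖ ≤ ‖(ϖ : K)‖ ^ ((p : ℤ) ^ a₀ - (absRamificationIdx p K : ℤ) * (a₀ : ℤ) + 1)) := by
  by_cases hcyc : ∀ π : K, ‖π‖ = ‖(ϖ : K)‖ → ‖1 + π ^ (p ^ a₀ * (p - 1)) / (p : K)‖ < 1
  · refine Or.inr ⟨residueDegree_eq_one_of_cyclotomicType p hϖ he hcyc, hcyc _ rfl, fun z hz => ?_⟩
    exact norm_le_zpow_succ_of_mem_logUnits_of_cyclotomicType p hϖ he hcyc hz
  · exact Or.inl (isGreatest_norm_logUnits_of_tie_of_not_cyclotomicType p hϖ he hcyc)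

/-- **Radius form of the dichotomy**: at a tie, `log_p(𝒪_K^×) ⊆ {‖z‖ ≤ r} ⟺ ‖ϖ‖^{p^{a₀} − e·a₀} ≤ r` off cyclotomic type
(the envelope is the least admissible radius there). [cite: NeukirchANT1999, Ch. II Prop. (5.5)] -/
theorem logUnits_subset_closedBall_iff_of_tie_of_not_cyclotomicType {ϖ : Kˣ} (hϖ : IsUniformizer ϖ) {a₀ : ℕ}
    (he : absRamificationIdx p K = p ^ a₀ * (p - 1))
    (hnc : ¬ ∀ π : K, ‖π‖ = ‖(ϖ : K)‖ → ‖1 + π ^ (p ^ a₀ * (p - 1)) / (p : K)‖ < 1) {r : ℝ} :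
    logUnits K ⊆ closedBall (0 : K) r ↔
      ‖(ϖ : K)‖ ^ ((p : ℤ) ^ a₀ - (absRamificationIdx p K : ℤ) * (a₀ : ℤ)) ≤ r := by
  obtain ⟨⟨z, hz, hzn⟩, hub⟩ := isGreatest_norm_logUnits_of_tie_of_not_cyclotomicType p hϖ he hnc
  constructor
  · intro h
    rw [← hzn]
    exact mem_closedBall_zero_iff.mp (h hz)
  · intro h w hw
    exact mem_closedBall_zero_iff.mpr ((hub ⟨w, hw, rfl⟩).trans h)

end Field

end ValuationProfile

end Literature.IUT.LogVolume

end
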